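import Summits.SmoothPoincare4.SmoothPoincare4.Theorems.CongruenceShadowsAbelianShadowStandardCutLagrangian
import Literature.Topology.FourManifolds.StandardTrisectionSlotSymmetry
import Literature.Topology.FourManifolds.SurfaceGroupAbelianisationKernels
import HarnessLib

/-!
# Helper I for stub `stub_layerStepZero` (line `nilpotent-genus-class`, crux
`CongruenceShadows.ShadowApproximation`, item stmt-SmoothPoincare4-14595): pair normalisation

Genus `3`, `S = S₃`, `Nᵢ = s4Kernels i` (`N₀ = ⟪a₀,a₁,b₂⟫`, `N₁ = ⟪a₀,b₁,a₂⟫`, `N₂ = ⟪b₀,a₁,a₂⟫`),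
`γ₂ = (⊤).lowerCentralSeries 1`, `H₁ = ℤ^{Fin 3 × Bool}` through `SurfaceGroup.abelianize`, and
`Λᵢ = span {δ_y : y ∈ s4CutSystem 0 i}` the coordinate Lagrangian of slot `i` (`= [Nᵢ]`, the landed
`span_image_stabilizeIter`).  Two hypotheses of the stub are used abstractly:
(AUTSYMP) every automorphism of `S₃` induces a `±`-isometry `F` of `(H₁, symplForm)`;
(REAL) every `±`-isometry stabilising `Λ₀` and `Λ₁` is induced by some `x ∈ Stab N₀ ∩ Stab N₁`.

* `realise_pair02` — REAL transported to the pair `(0, 2)` by the slot symmetry `σ` with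
  `σ N₀ = N₀`, `σ N₁ = N₂` (`exists_aut_pair_stabilizeIter`): a `±`-isometry stabilising `Λ₀, Λ₂`
  is induced by some `x ∈ Stab N₀ ∩ Stab N₂` (`x = σ x' σ⁻¹`, `x'` realising `σ̄⁻¹ F σ̄`).
* `exists_ia_of_pair` — **pair normalisation**: if `α ∈ Stab N₀` carries `N₂` onto `P` with
  `P γ₂ = N₂ γ₂`, then some IA-automorphism `α' = α ∘ x⁻¹` (`ab ∘ α' = ab`) carries `N₂` onto `P`.
Glue only (spans in `H₁`, `Submodule.map` along compositions); no definitions.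
-/

set_option linter.dupNamespace false

noncomputable section

open Literature.Topology.FourManifolds Literature.Algebra.Lie Multiplicative

namespace Summit.SmoothPoincare4.SmoothPoincare4.Theorems.ShadowApproximation.NilpotentGenusClass


/-! ## Subgroups under automorphisms -/

section transport

variable {G : Type*} [Group G]

/-- `P ↦ P.map` along a composite of automorphisms. [folklore] -/
theorem map_trans (e₁ e₂ : G ≃* G) (P : Subgroup G) :
    P.map (e₁.trans e₂).toMonoidHom = (P.map e₁.toMonoidHom).map e₂.toMonoidHom := by
  rw [Subgroup.map_map]
  rfl

/-- `e⁻¹` undoes `e` on subgroups. [folklore] -/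
theorem map_map_symm (e : G ≃* G) (P : Subgroup G) :
    (P.map e.toMonoidHom).map e.symm.toMonoidHom = P := by
  ext x
  simp

/-- `e` undoes `e⁻¹` on subgroups. [folklore] -/
theorem map_symm_map (e : G ≃* G) (P : Subgroup G) :
    (P.map e.symm.toMonoidHom).map e.toMonoidHom = P := by
  ext x
  simp

/-- If `e(P) = Q` then `e⁻¹(Q) = P`. [folklore] -/
theorem map_symm_of_map (e : G ≃* G) {P Q : Subgroup G} (h : P.map e.toMonoidHom = Q) :
    Q.map e.symm.toMonoidHom = P := by
  rw [← h, map_map_symm]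

/-- An automorphism maps `⊤` onto `⊤`. [folklore] -/
theorem map_top_equiv (ψ : G ≃* G) : (⊤ : Subgroup G).map ψ.toMonoidHom = ⊤ := by
  rw [← MonoidHom.range_eq_map, MonoidHom.range_eq_top.2 ψ.surjective]

/-- The lower central series is invariant under automorphisms. [folklore] -/
theorem map_lcs_equiv (ψ : G ≃* G) (n : ℕ) :
    ((⊤ : Subgroup G).lowerCentralSeries n).map ψ.toMonoidHom = (⊤ : Subgroup G).lowerCentralSeries n := by
  rw [Subgroup.map_lowerCentralSeries, map_top_equiv]

end transport

/-! ## Spans in `H₁` -/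

/-- The image in `H₁` of `P.map ψ` is `F` applied to the image of `P`, when `ψ` induces `F`.
[folklore] -/
theorem span_image_map (ψ : (SurfaceGroup 3) ≃* (SurfaceGroup 3)) (F : (surfaceGen 3 → ℤ) ≃ₗ[ℤ] (surfaceGen 3 → ℤ)) (hF : ∀ s, toAdd (SurfaceGroup.abelianize 3 (ψ s)) = F (toAdd (SurfaceGroup.abelianize 3 s)))
    (P : Subgroup (SurfaceGroup 3)) :
    Submodule.span ℤ ((fun s => toAdd (SurfaceGroup.abelianize 3 s)) '' (P.map ψ.toMonoidHom : Set (SurfaceGroup 3))) =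
      (Submodule.span ℤ ((fun s => toAdd (SurfaceGroup.abelianize 3 s)) '' (P : Set (SurfaceGroup 3)))).map F.toLinearMap := by
  -- adapted from the lead's skeleton work/ShadowApproximation.lean (glue §4)
  rw [Submodule.map_span]
  congr 1
  ext v
  constructor
  · rintro ⟨_, ⟨s, hs, rfl⟩, rfl⟩
    exact ⟨toAdd (SurfaceGroup.abelianize 3 s), ⟨s, hs, rfl⟩, (hF s).symm⟩
  · rintro ⟨_, ⟨s, hs, rfl⟩, rfl⟩
    exact ⟨ψ s, ⟨s, hs, rfl⟩, hF s⟩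

/-- `γ₂ = ker ab` is invisible in `H₁`: the image of `P ⊔ γ₂` spans the same as the image of `P`.
[folklore] -/
theorem span_image_sup_γ (P : Subgroup (SurfaceGroup 3)) :
    Submodule.span ℤ ((fun s => toAdd (SurfaceGroup.abelianize 3 s)) '' ((P ⊔ ((⊤ : Subgroup (SurfaceGroup 3)).lowerCentralSeries 1) : Subgroup (SurfaceGroup 3)) : Set (SurfaceGroup 3))) =
      Submodule.span ℤ ((fun s => toAdd (SurfaceGroup.abelianize 3 s)) '' (P : Set (SurfaceGroup 3))) := by
  -- adapted from the lead's skeleton work/ShadowApproximation.lean (glue §4)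
  have h := SurfaceGroup.span_image_sup (g := 3) P ((⊤ : Subgroup (SurfaceGroup 3)).lowerCentralSeries 1)
  have h0 : Submodule.span ℤ ((fun s => toAdd (SurfaceGroup.abelianize 3 s)) '' ((((⊤ : Subgroup (SurfaceGroup 3)).lowerCentralSeries 1) : Subgroup (SurfaceGroup 3)) : Set (SurfaceGroup 3))) = ⊥ := by
    rw [Submodule.span_eq_bot]
    rintro _ ⟨s, hs, rfl⟩
    have hs' : s ∈ (SurfaceGroup.abelianize 3).ker := by
      rw [SurfaceGroup.ker_abelianize_eq_lowerCentralSeries]; exact hs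
    rw [MonoidHom.mem_ker] at hs'
    change toAdd (SurfaceGroup.abelianize 3 s) = 0
    rw [hs', toAdd_one]
  rw [h, h0, sup_bot_eq]

/-- The abelian shadow of `Nᵢ` is the coordinate Lagrangian `Λᵢ` (the landed
`span_image_stabilizeIter` at `m = 0`). [folklore] -/
theorem span_image_N (i : Fin 3) :
    Submodule.span ℤ ((fun s => toAdd (SurfaceGroup.abelianize 3 s)) '' ((s4Kernels i) : Set (SurfaceGroup 3))) = (Submodule.span ℤ ((fun y => (Pi.single y (1 : ℤ) : surfaceGen 3 → ℤ)) '' s4CutSystem 0 i)) :=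
  Summit.SmoothPoincare4.SmoothPoincare4.Theorems.AbelianShadowStandard.span_image_stabilizeIter 0 i

/-- If `φ` induces `F` on `H₁` and `φ(Nᵢ) = Nⱼ`, then `F(Λᵢ) = Λⱼ`. [folklore] -/
theorem map_Λ_of_map_eq (φ : (SurfaceGroup 3) ≃* (SurfaceGroup 3)) (F : (surfaceGen 3 → ℤ) ≃ₗ[ℤ] (surfaceGen 3 → ℤ)) (hF : ∀ s, toAdd (SurfaceGroup.abelianize 3 (φ s)) = F (toAdd (SurfaceGroup.abelianize 3 s)))
    {i j : Fin 3} (h : (s4Kernels i).map φ.toMonoidHom = (s4Kernels j)) : (Submodule.span ℤ ((fun y => (Pi.single y (1 : ℤ) : surfaceGen 3 → ℤ)) '' s4CutSystem 0 i)).map F.toLinearMap = (Submodule.span ℤ ((fun y => (Pi.single y (1 : ℤ) : surfaceGen 3 → ℤ)) '' s4CutSystem 0 j)) := by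
  have e : Submodule.span ℤ ((fun s => toAdd (SurfaceGroup.abelianize 3 s)) '' (((s4Kernels i).map φ.toMonoidHom : Subgroup (SurfaceGroup 3)) : Set (SurfaceGroup 3))) =
      Submodule.span ℤ ((fun s => toAdd (SurfaceGroup.abelianize 3 s)) '' ((s4Kernels j) : Set (SurfaceGroup 3))) := by rw [h]
  rw [span_image_map φ F hF, span_image_N, span_image_N] at e
  exact e

/-- If `φ` induces `F` on `H₁` and `φ(Nᵢ) = P` with `P γ₂ = Nᵢ γ₂`, then `F(Λᵢ) = Λᵢ`. [folklore] -/
theorem map_Λ_of_map_sup_eq (φ : (SurfaceGroup 3) ≃* (SurfaceGroup 3)) (F : (surfaceGen 3 → ℤ) ≃ₗ[ℤ] (surfaceGen 3 → ℤ)) (hF : ∀ s, toAdd (SurfaceGroup.abelianize 3 (φ s)) = F (toAdd (SurfaceGroup.abelianize 3 s)))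
    {P : Subgroup (SurfaceGroup 3)} {i : Fin 3} (h : (s4Kernels i).map φ.toMonoidHom = P) (hP : P ⊔ ((⊤ : Subgroup (SurfaceGroup 3)).lowerCentralSeries 1) = (s4Kernels i) ⊔ ((⊤ : Subgroup (SurfaceGroup 3)).lowerCentralSeries 1)) :
    (Submodule.span ℤ ((fun y => (Pi.single y (1 : ℤ) : surfaceGen 3 → ℤ)) '' s4CutSystem 0 i)).map F.toLinearMap = (Submodule.span ℤ ((fun y => (Pi.single y (1 : ℤ) : surfaceGen 3 → ℤ)) '' s4CutSystem 0 i)) := by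
  have e : Submodule.span ℤ ((fun s => toAdd (SurfaceGroup.abelianize 3 s)) '' (((s4Kernels i).map φ.toMonoidHom : Subgroup (SurfaceGroup 3)) : Set (SurfaceGroup 3))) =
      Submodule.span ℤ ((fun s => toAdd (SurfaceGroup.abelianize 3 s)) '' ((s4Kernels i) : Set (SurfaceGroup 3))) := by
    rw [h, ← span_image_sup_γ P, hP, span_image_sup_γ]
  rw [span_image_map φ F hF, span_image_N] at e
  exact e

/-! ## Isometries -/

/-- The inverse of an `ε`-isometry (`ε = ±1`) is an `ε`-isometry. [folklore] -/
theorem symplForm_symm (F : (surfaceGen 3 → ℤ) ≃ₗ[ℤ] (surfaceGen 3 → ℤ)) {ε : ℤ} (hε : ε = 1 ∨ ε = -1)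
    (hF : ∀ u v : (surfaceGen 3 → ℤ), symplForm (F u) (F v) = ε * symplForm u v) (u v : (surfaceGen 3 → ℤ)) :
    symplForm (F.symm u) (F.symm v) = ε * symplForm u v := by
  have h := hF (F.symm u) (F.symm v)
  rw [LinearEquiv.apply_symm_apply, LinearEquiv.apply_symm_apply] at h
  rw [h, ← mul_assoc]
  rcases hε with rfl | rfl <;> simp

/-- `Submodule.map` along a composite of linear equivalences. [folklore] -/
theorem submodule_map_trans (e₁ e₂ : (surfaceGen 3 → ℤ) ≃ₗ[ℤ] (surfaceGen 3 → ℤ)) (p : Submodule ℤ (surfaceGen 3 → ℤ)) :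
    p.map (e₁.trans e₂).toLinearMap = (p.map e₁.toLinearMap).map e₂.toLinearMap := by
  rw [← Submodule.map_comp]
  rfl

section Realise

variable (hA : ∀ (φ : SurfaceGroup 3 ≃* SurfaceGroup 3),
    ∃ (F : (surfaceGen 3 → ℤ) ≃ₗ[ℤ] (surfaceGen 3 → ℤ)) (ε : ℤ), (ε = 1 ∨ ε = -1) ∧
      (∀ s : SurfaceGroup 3,
        toAdd (SurfaceGroup.abelianize 3 (φ s)) = F (toAdd (SurfaceGroup.abelianize 3 s))) ∧
      ∀ u v : surfaceGen 3 → ℤ, symplForm (F u) (F v) = ε * symplForm u v)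
variable (hR : ∀ (F : (surfaceGen 3 → ℤ) ≃ₗ[ℤ] (surfaceGen 3 → ℤ)) (ε : ℤ), (ε = 1 ∨ ε = -1) →
    (∀ u v : surfaceGen 3 → ℤ, symplForm (F u) (F v) = ε * symplForm u v) →
    (Submodule.span ℤ ((fun y => (Pi.single y (1 : ℤ) : surfaceGen 3 → ℤ)) ''
        s4CutSystem 0 0)).map F.toLinearMap =
      Submodule.span ℤ ((fun y => (Pi.single y (1 : ℤ) : surfaceGen 3 → ℤ)) '' s4CutSystem 0 0) →
    (Submodule.span ℤ ((fun y => (Pi.single y (1 : ℤ) : surfaceGen 3 → ℤ)) ''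
        s4CutSystem 0 1)).map F.toLinearMap =
      Submodule.span ℤ ((fun y => (Pi.single y (1 : ℤ) : surfaceGen 3 → ℤ)) '' s4CutSystem 0 1) →
    ∃ x : SurfaceGroup 3 ≃* SurfaceGroup 3,
      (s4Kernels 0).map x.toMonoidHom = s4Kernels 0 ∧
      (s4Kernels 1).map x.toMonoidHom = s4Kernels 1 ∧
      ∀ s : SurfaceGroup 3,
        toAdd (SurfaceGroup.abelianize 3 (x s)) = F (toAdd (SurfaceGroup.abelianize 3 s)))

include hA hR in
/-- **Goeritz realisation for the pair `(0, 2)`** from the realisation hypothesis for the pair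
`(0, 1)` by slot symmetry: every `±`-isometry of `H₁(S₃)` stabilising `Λ₀` and `Λ₂` is induced by
some `x ∈ Stab N₀ ∩ Stab N₂`. [folklore] -/
theorem realise_pair02 (F : (surfaceGen 3 → ℤ) ≃ₗ[ℤ] (surfaceGen 3 → ℤ)) (ε : ℤ) (hε : ε = 1 ∨ ε = -1)
    (hF : ∀ u v : (surfaceGen 3 → ℤ), symplForm (F u) (F v) = ε * symplForm u v)
    (h0 : (Submodule.span ℤ ((fun y => (Pi.single y (1 : ℤ) : surfaceGen 3 → ℤ)) '' s4CutSystem 0 0)).map F.toLinearMap = (Submodule.span ℤ ((fun y => (Pi.single y (1 : ℤ) : surfaceGen 3 → ℤ)) '' s4CutSystem 0 0))) (h2 : (Submodule.span ℤ ((fun y => (Pi.single y (1 : ℤ) : surfaceGen 3 → ℤ)) '' s4CutSystem 0 2)).map F.toLinearMap = (Submodule.span ℤ ((fun y => (Pi.single y (1 : ℤ) : surfaceGen 3 → ℤ)) '' s4CutSystem 0 2))) :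
    ∃ x : (SurfaceGroup 3) ≃* (SurfaceGroup 3), (s4Kernels 0).map x.toMonoidHom = (s4Kernels 0) ∧ (s4Kernels 2).map x.toMonoidHom = (s4Kernels 2) ∧
      ∀ s, toAdd (SurfaceGroup.abelianize 3 (x s)) = F (toAdd (SurfaceGroup.abelianize 3 s)) := by
  -- the slot symmetry `σ`: `σ N₀ = N₀`, `σ N₁ = N₂`, and its `±`-isometry `Fσ`
  obtain ⟨σ, hσ0, hσ1⟩ := exists_aut_pair_stabilizeIter 0 0 2 (by decide)
  have hσ0' : (s4Kernels 0).map σ.toMonoidHom = (s4Kernels 0) := hσ0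
  have hσ1' : (s4Kernels 1).map σ.toMonoidHom = (s4Kernels 2) := hσ1
  obtain ⟨Fσ, εσ, hεσ, hFσ, hisoσ⟩ := hA σ
  have hΛ0σ : (Submodule.span ℤ ((fun y => (Pi.single y (1 : ℤ) : surfaceGen 3 → ℤ)) '' s4CutSystem 0 0)).map Fσ.toLinearMap = (Submodule.span ℤ ((fun y => (Pi.single y (1 : ℤ) : surfaceGen 3 → ℤ)) '' s4CutSystem 0 0)) := map_Λ_of_map_eq σ Fσ hFσ hσ0'
  have hΛ1σ : (Submodule.span ℤ ((fun y => (Pi.single y (1 : ℤ) : surfaceGen 3 → ℤ)) '' s4CutSystem 0 1)).map Fσ.toLinearMap = (Submodule.span ℤ ((fun y => (Pi.single y (1 : ℤ) : surfaceGen 3 → ℤ)) '' s4CutSystem 0 2)) := map_Λ_of_map_eq σ Fσ hFσ hσ1'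
  -- `G = σ̄⁻¹ F σ̄` is a `±`-isometry stabilising `Λ₀`, `Λ₁`
  set G : (surfaceGen 3 → ℤ) ≃ₗ[ℤ] (surfaceGen 3 → ℤ) := (Fσ.trans F).trans Fσ.symm with hG
  have hGapp : ∀ v, G v = Fσ.symm (F (Fσ v)) := fun v => rfl
  have hGiso : ∀ u v : (surfaceGen 3 → ℤ), symplForm (G u) (G v) = ε * symplForm u v := by
    intro u v
    rw [hGapp, hGapp, symplForm_symm Fσ hεσ hisoσ, hF, hisoσ]
    rcases hεσ with h | h <;> rw [h] <;> ring
  have hGΛ0 : (Submodule.span ℤ ((fun y => (Pi.single y (1 : ℤ) : surfaceGen 3 → ℤ)) '' s4CutSystem 0 0)).map G.toLinearMap = (Submodule.span ℤ ((fun y => (Pi.single y (1 : ℤ) : surfaceGen 3 → ℤ)) '' s4CutSystem 0 0)) := by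
    rw [hG, submodule_map_trans, submodule_map_trans, hΛ0σ, h0]
    exact (Submodule.map_symm_eq_iff Fσ).2 hΛ0σ
  have hGΛ1 : (Submodule.span ℤ ((fun y => (Pi.single y (1 : ℤ) : surfaceGen 3 → ℤ)) '' s4CutSystem 0 1)).map G.toLinearMap = (Submodule.span ℤ ((fun y => (Pi.single y (1 : ℤ) : surfaceGen 3 → ℤ)) '' s4CutSystem 0 1)) := by
    rw [hG, submodule_map_trans, submodule_map_trans, hΛ1σ, h2]
    exact (Submodule.map_symm_eq_iff Fσ).2 hΛ1σ
  -- realise `G` in `Stab N₀ ∩ Stab N₁` and conjugate back by `σ`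
  obtain ⟨x', hx'0, hx'1, hx'⟩ := hR G ε hε hGiso hGΛ0 hGΛ1
  have hab_symm : ∀ s, toAdd (SurfaceGroup.abelianize 3 (σ.symm s)) = Fσ.symm (toAdd (SurfaceGroup.abelianize 3 s)) := fun s => by
    rw [eq_comm, LinearEquiv.symm_apply_eq, ← hFσ, MulEquiv.apply_symm_apply]
  refine ⟨σ.symm.trans (x'.trans σ), ?_, ?_, fun s => ?_⟩
  · rw [map_trans, map_trans, map_symm_of_map σ hσ0', hx'0, hσ0']
  · rw [map_trans, map_trans, map_symm_of_map σ hσ1', hx'1, hσ1']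
  · rw [MulEquiv.trans_apply, MulEquiv.trans_apply, hFσ, hx', hab_symm, hGapp]
    simp

include hA hR in
/-- **Pair normalisation.** If `α ∈ Stab N₀` carries `N₂` onto `P` and `P γ₂ = N₂ γ₂`, then some
IA-automorphism `α'` (`α' s · s⁻¹ ∈ γ₂` for all `s`) carries `N₂` onto `P`: `α' = α ∘ x⁻¹` for a
realiser `x ∈ Stab N₀ ∩ Stab N₂` of the `±`-isometry induced by `α` (which stabilises `Λ₀ = [N₀]`
and `Λ₂ = [N₂] = [P]`). [folklore] -/
theorem exists_ia_of_pair {P : Subgroup (SurfaceGroup 3)} {α : (SurfaceGroup 3) ≃* (SurfaceGroup 3)} (hα0 : (s4Kernels 0).map α.toMonoidHom = (s4Kernels 0))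
    (hα2 : (s4Kernels 2).map α.toMonoidHom = P) (hP : P ⊔ ((⊤ : Subgroup (SurfaceGroup 3)).lowerCentralSeries 1) = (s4Kernels 2) ⊔ ((⊤ : Subgroup (SurfaceGroup 3)).lowerCentralSeries 1)) :
    ∃ α' : (SurfaceGroup 3) ≃* (SurfaceGroup 3), (∀ s, α' s * s⁻¹ ∈ ((⊤ : Subgroup (SurfaceGroup 3)).lowerCentralSeries 1)) ∧ (s4Kernels 2).map α'.toMonoidHom = P := by
  obtain ⟨F, ε, hε, hF, hiso⟩ := hA α
  have hΛ0 : (Submodule.span ℤ ((fun y => (Pi.single y (1 : ℤ) : surfaceGen 3 → ℤ)) '' s4CutSystem 0 0)).map F.toLinearMap = (Submodule.span ℤ ((fun y => (Pi.single y (1 : ℤ) : surfaceGen 3 → ℤ)) '' s4CutSystem 0 0)) := map_Λ_of_map_eq α F hF hα0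
  have hΛ2 : (Submodule.span ℤ ((fun y => (Pi.single y (1 : ℤ) : surfaceGen 3 → ℤ)) '' s4CutSystem 0 2)).map F.toLinearMap = (Submodule.span ℤ ((fun y => (Pi.single y (1 : ℤ) : surfaceGen 3 → ℤ)) '' s4CutSystem 0 2)) := map_Λ_of_map_sup_eq α F hF hα2 hP
  obtain ⟨x, _, hx2, hx⟩ := realise_pair02 hA hR F ε hε hiso hΛ0 hΛ2
  have hab_symm : ∀ s, toAdd (SurfaceGroup.abelianize 3 (x.symm s)) = F.symm (toAdd (SurfaceGroup.abelianize 3 s)) := fun s => by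
    rw [eq_comm, LinearEquiv.symm_apply_eq, ← hx, MulEquiv.apply_symm_apply]
  refine ⟨x.symm.trans α, fun s => ?_, ?_⟩
  · have hk : (x.symm.trans α) s * s⁻¹ ∈ (SurfaceGroup.abelianize 3).ker := by
      rw [MonoidHom.mem_ker, map_mul, map_inv, mul_inv_eq_one]
      apply toAdd.injective
      rw [MulEquiv.trans_apply, hF, hab_symm, LinearEquiv.apply_symm_apply]
    rwa [SurfaceGroup.ker_abelianize_eq_lowerCentralSeries] at hk
  · rw [map_trans, map_symm_of_map x hx2, hα2]

end Realise

/-- **Registered helper `helper_layerStepZeroPair`** (sub-goal of stub `stub_layerStepZero`, crux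
stmt-SmoothPoincare4-14595): pair normalisation at genus `3`, in closed form — given (AUTSYMP) at
genus `3` and (REAL) for the pair `(0, 1)`, an `α ∈ Stab N₀` with `α(N₂) = P`, `P γ₂ = N₂ γ₂` is
replaced by an IA-automorphism carrying `N₂` onto `P`. [folklore] -/
theorem helper_layerStepZeroPair : (∀ (φ : SurfaceGroup 3 ≃* SurfaceGroup 3), ∃ (F : (surfaceGen 3 → ℤ) ≃ₗ[ℤ] (surfaceGen 3 → ℤ)) (ε : ℤ), (ε = 1 ∨ ε = -1) ∧ (∀ s : SurfaceGroup 3, toAdd (SurfaceGroup.abelianize 3 (φ s)) = F (toAdd (SurfaceGroup.abelianize 3 s))) ∧ ∀ u v : surfaceGen 3 → ℤ, symplForm (F u) (F v) = ε * symplForm u v) → (∀ (F : (surfaceGen 3 → ℤ) ≃ₗ[ℤ] (surfaceGen 3 → ℤ)) (ε : ℤ), (ε = 1 ∨ ε = -1) → (∀ u v : surfaceGen 3 → ℤ, symplForm (F u) (F v) = ε * symplForm u v) → (Submodule.span ℤ ((fun y => (Pi.single y (1 : ℤ) : surfaceGen 3 → ℤ)) '' s4CutSystem 0 0)).map F.toLinearMap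 = Submodule.span ℤ ((fun y => (Pi.single y (1 : ℤ) : surfaceGen 3 → ℤ)) '' s4CutSystem 0 0) → (Submodule.span ℤ ((fun y => (Pi.single y (1 : ℤ) : surfaceGen 3 → ℤ)) '' s4CutSystem 0 1)).map F.toLinearMap = Submodule.span ℤ ((fun y => (Pi.single y (1 : ℤ) : surfaceGen 3 → ℤ)) '' s4CutSystem 0 1) → ∃ x : SurfaceGroup 3 ≃* SurfaceGroup 3, (s4Kernels 0).map x.toMonoidHom = s4Kernels 0 ∧ (s4Kernels 1).map x.toMonoidHom = s4Kernels 1 ∧ ∀ s : SurfaceGroup 3, toAdd (SurfaceGroup.abelianize 3 (x s)) = F (toAdd (SurfaceGroup.abelianize 3 s))) → ∀ (P : Subgroup (SurfaceGroup 3)) (α : SurfaceGroup 3 ≃* SurfaceGroup 3), (s4Kernels 0).map α.toMonoidHom = s4Kernels 0 → (s4Kernels 2).map α.toMonoidHom = P → P ⊔ (⊤ : Subgroup (SurfaceGroup 3)).lowerCentralSeries 1 = s4Kernels 2 ⊔ (⊤ : Subgroup (SurfaceGroup 3)).lowerCentralSeries 1 → ∃ α' : SurfaceGroup 3 ≃*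 SurfaceGroup 3, (∀ s : SurfaceGroup 3, α' s * s⁻¹ ∈ (⊤ : Subgroup (SurfaceGroup 3)).lowerCentralSeries 1) ∧ (s4Kernels 2).map α'.toMonoidHom = P :=
  fun hA hR _ _ hα0 hα2 hP => exists_ia_of_pair hA hR hα0 hα2 hP

end Summit.SmoothPoincare4.SmoothPoincare4.Theorems.ShadowApproximation.NilpotentGenusClass

end
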